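import Literature.MathematicalPhysics.QuantumFieldTheory.BalabanImbrieJaffe1984to88.BIJ88Eq596Display

/-!
# `BalabanImbrieJaffe1984to88.BIJ88RT54ScalarSubst` — T. Bałaban, J. Imbrie, A. Jaffe, *Effective action and cluster properties of the
abelian Higgs model*, Commun. Math. Phys. **114** (1988) 257–315 [BalabanImbrieJaffe1988], Sect. 5.4 p. 282 [PDF 26] (the paragraph after
(5.4.6)) and Sect. 5.8 (5.8.1) p. 295 [PDF 39]: **THE SUBSTITUTIONS OF THE SCALAR FIELDS IN THE DENSITY DISPLAY, AT MEASURE LEVEL.**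
Verbatim, p. 282: *"There are still the phase factors at φ and ψ. We define φ′(x) = φ(x)e^{ie_k(Λ̄₃^{(k)}C_{k,loc}A′)(x)}, ψ′(y) = ψ(y)e^{ie_k(Λ̄₃^{(k)}C_{k,loc}A′)(y)}.
By (2.26), C_{k,loc}(x, b′) approximates the phase factors in (5.4.5), while being independent of □₀. The measure dφ is rotationally invariant, so
we can replace dφ with dφ′ and drop the prime. We have not yet integrated over ψ, so a different density is obtained by replacing ψ′ with ψ.
However, the new density ρ^L_{k+1}(v, ψ) still has the property that ∫dvdψ ρ^L_{k+1}(v, ψ) = [F]."*  p. 295: *"To eliminate most of the linear term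
⟨ψ, Q(u_{k+1})φ⟩ in the small field region, we make a translation φ = φ^{(k)} + aL⁻²Λ₇^{(k)}C^{(k)}_{loc}(u_{k+1})Q*(u_{k+1})ψ. (5.8.1)"*.
PROVED for the display `IsDT` of `BIJ88Eq596Display` (line 1 of (5.9.6)): (i) **`isDT_substPhi`** — replacing `φ` in the bracket by `e(φ)` for ANY
family of Lebesgue-preserving measurable equivalences `e` of `ℂ^{T₁}` depending on the term and on all the other variables `({u^{(j)}}, u′, v, ψ)`
does not change the density: instances the ROTATION `φ ↦ φ′ = e^{ie_kλ}φ` with a field-dependent phase (`isDT_rotatePhi`: *"The measure dφ is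
rotationally invariant, so we can replace dφ with dφ′ and drop the prime"*) and the TRANSLATION (5.8.1) `φ = φ^{(k)} + c(u_{k+1}, ψ)` with a field- and
`ψ`-dependent shift (`isDT_translatePhi`); (ii) **THE RENAMING `ψ′ → ψ` GIVES A NEW DENSITY WITH THE SAME INTEGRALS AGAINST ψ-ROTATION-INVARIANT
TEST FUNCTIONS** (`integral_eq_of_rename`): if the old bracket is `J₁ = J₂(…, ψ′)` with `ψ′ = e^{ie_kλ}ψ` (`λ` depending on `{u^{(j)}}, u′, v` only) and
`ρ₁`, `ρ₂` are the densities of the displays with brackets `J₁`, `J₂` (`ρ₂` = *"replacing ψ′ with ψ"*), then `∫dvdψ ρ₂ g = ∫dvdψ ρ₁ g` for every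
bounded measurable `g` with `g(v, e^{iμ}ψ) = g(v, ψ)` — in particular **`∫dvdψ ρ₂ = ∫dvdψ ρ₁`** (`= [F]` by gens 5–8: *"the new density still has the
property that ∫dvdψ ρ^L_{k+1} = [F]"*), while `ρ₂ ≠ ρ₁` in general (*"a different density is obtained"*; nothing more is claimed).  Seat p34 gen 9,
file 2 (own lineage = the C1/C2 renormalization-transformation line).

statement-level skeleton of published theorems with citation tags; proofs where landed; nothing here is a claim about the Yang–Mills mass gap

PDF held: `paper:balaban1988-cmp114-bij-abelian-higgs-effective-action` (journal page = PDF page + 256); p. 282 [PDF 26] re-read this session as an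
image (r16's render `HOME/lit-balaban-r16/renders/cmp114/original-p026-x2.png`), p. 295 [PDF 39] from the text layer (`lit read … --pages 39-43`; the
display (5.8.1) itself is garbled there and is quoted after row C2.Eq5.8.1-5.8.3 of r16's ROWS-C2-part2, read by r16 on the image).
CITATION HEADER (lean-in-tree rule).  Part of the lit-balaban TYPED SKELETON (HOME `run/shared/lean/pub/lit-balaban/`), PHASE-2 proof seat p34
gen 9 (unit `lit-balaban-p34-g9`; TAKING line HOME/STATUS.md 2026-08-21T21:12:57Z).  Rows served: **`C2.Eq5.4.1-5.4.6`** (the p. 282 measure sentences;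
owner r16; field-level companions: r18's (4.16) `bgGaugePhi`, r16 g8's `BIJ88RotationResidual282`), **`C2.Eq5.8.1-5.8.3`** member (5.8.1) at measure
level (field level: p02's `BIJ88ScalarTransl582.transl581_eq`, `BIJ88ScalarSummary583`), `C2.Eq5.9.6` (operations between (5.3.6) and (5.9.6)).

THE READING.  In `IsDT ν terms Λ Qu J ρ̃` the bracket `J_t({u^{(j)}}, u′, v, φ, ψ)` is integrated `∫dv′∫ν(du)∫Π𝒟u^{(j)}∫dψ∫𝒟φ` with `𝒟φ` innermost, so a
substitution of `φ` depending on all the other variables is a change of variables in the innermost integral at fixed values of the others, and a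
rotation of `ψ` depending on `({u^{(j)}}, u′, v)` one in the `dψ`-integral at fixed outer variables (Mathlib's `MeasurePreserving.integral_comp'`
for measurable equivalences — no measurability or integrability of the bracket is needed).  Rotations = r18's `rotField`/`twist` by a
`U(1)`-valued site field (`measurePreserving_rotField`), translations = Mathlib's `MeasurableEquiv.addRight` (`measurePreserving_add_right` for the
Lebesgue = additive Haar measure of `ℂ^{T₁}`).

WHAT IS PROVED (theorems only; 0 `sorry`; no def, no `Prop`-valued fact; standard axioms).  §1 `isDT_substPhi` (general), `isDT_rotatePhi` (p. 282),
`isDT_translatePhi` ((5.8.1)); §2 `term_rename_eq` (one term), **`integral_eq_of_rename`**, `integral_eq_of_rename_one` (p. 282, the new density).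
NOT DONE HERE (honest scope).  The identification of the phases with `e_k(Λ̄₃^{(k)}C_{k,loc}A′)` and of the shift with `aL⁻²Λ₇^{(k)}C^{(k)}_{loc}(u_{k+1})Q*(u_{k+1})ψ`
(E-level data of the rows above; here they are arbitrary measurable-in-nothing families — no measurability is even needed), the existence of
the renamed density for a given bracket (file `BIJ88Eq596Exists` of this seat), the identities (5.4.x)/(5.8.2)–(5.8.3) rewriting the bracket
(`IsDT.congr`), `[F]` itself (gens 5–8: `BIJ88RT51NoChange.bracket_eq_integral_of_isRT511`), bounds.  Imports `BIJ88Eq596Display` only.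
-/

namespace Literature.MathematicalPhysics.QuantumFieldTheory.BalabanImbrieJaffe1984to88.BIJ88RT54ScalarSubst

open Literature.MathematicalPhysics.QuantumFieldTheory.Balaban1983to89
open BIJ88Sect3Statements (U1 toC)
open BIJ85Sect1Model (HiggsField)
open BIJ85RT33 (twist twist_apply)
open BIJ88RenormTransf311 (axialMeasure rotField rotField_apply measurePreserving_rotField)
open BIJ88InductiveForm41 (Prev prevMeasure)
open BIJ85BlockAveragesTorus (qU)
open BIJ88Eq596Display (uCut vCut IsDT)
open scoped BigOperators ENNReal
open _root_.MeasureTheory _root_.MeasureTheory.Measure Complex Function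

noncomputable section

variable {P : Params} {k : ℕ}

/-! ## §1 Substitutions of the fine scalar field `φ` -/

section Phi

variable {ι : Type*} {ν : Measure (GaugeField P k U1)} {terms : Finset ι} {Λ : ι → Finset (PBond P (k+1))}
variable {Qu : GaugeField P k U1 → GaugeField P (k+1) U1}
variable {J : ι → Prev P k → GaugeField P k U1 → GaugeField P (k+1) U1 → HiggsField P k → HiggsField P (k+1) → ℂ}
variable {ρL : GaugeField P (k+1) U1 → HiggsField P (k+1) → ℂ}

/-- **SUBSTITUTING THE FINE SCALAR FIELD IN THE BRACKET**: for any family `e_t({u^{(j)}}, u′, v, ψ)` of measurable equivalences of `ℂ^{T₁}` preserving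
`𝒟φ`, a density satisfying line 1 of (5.9.6) with bracket `J` satisfies it with the bracket `({u^{(j)}}, u′, v, φ, ψ) ↦ J_t({u^{(j)}}, u′, v, e_t(…)(φ), ψ)`
— the change of variables `φ = e(φ^{(k)})` in the innermost integral, at fixed values of all other variables (no hypothesis on `J`).
[cite: BalabanImbrieJaffe1988, (5.8.1) p.295] -/
theorem isDT_substPhi (e : ι → Prev P k → GaugeField P k U1 → GaugeField P (k+1) U1 → HiggsField P (k+1) → (HiggsField P k ≃ᵐ HiggsField P k))
    (he : ∀ t ∈ terms, ∀ prev u' v ψ, MeasurePreserving (e t prev u' v ψ) (volume : Measure (HiggsField P k)) volume)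
    (h : IsDT ν terms Λ Qu J ρL) :
    IsDT ν terms Λ Qu (fun t prev u' v φ ψ => J t prev u' v (e t prev u' v ψ φ) ψ) ρL := by
  intro g hg hb
  rw [h g hg hb]
  refine Finset.sum_congr rfl fun t ht => ?_
  refine integral_congr_ae (ae_of_all _ fun v' => integral_congr_ae (ae_of_all _ fun U => ?_))
  refine integral_congr_ae (ae_of_all _ fun prev => integral_congr_ae (ae_of_all _ fun ψ => ?_))
  dsimp only
  exact ((he t ht prev _ _ ψ).integral_comp' (fun φ => J t prev (uCut Qu (Λ t) U) (vCut Qu (Λ t) U v') φ ψ * g (vCut Qu (Λ t) U v', ψ))).symm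

/-- **p. 282: *"The measure dφ is rotationally invariant, so we can replace dφ with dφ′ and drop the prime"*** — PROVED at measure level: for any
family of `U(1)`-valued site fields `λ_t({u^{(j)}}, u′, v, ψ)` (the printed one is `e^{ie_k(Λ̄₃^{(k)}C_{k,loc}A′)}`, a function of `u′ = e^{ie_kA′}`), a
density satisfying line 1 of (5.9.6) with bracket `J` satisfies it with the bracket evaluated at the rotated field `φ′ = λφ` (r18's `twist`;
`𝒟φ`-invariance = r18's `measurePreserving_rotField`). [cite: BalabanImbrieJaffe1988, (5.4.6) p.282] -/
theorem isDT_rotatePhi (lam : ι → Prev P k → GaugeField P k U1 → GaugeField P (k+1) U1 → HiggsField P (k+1) → GaugeTransf P k U1)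
    (h : IsDT ν terms Λ Qu J ρL) :
    IsDT ν terms Λ Qu (fun t prev u' v φ ψ => J t prev u' v (twist (lam t prev u' v ψ) φ) ψ) ρL := by
  have h1 := isDT_substPhi (fun t prev u' v ψ => rotField (lam t prev u' v ψ)) (fun t _ prev u' v ψ => measurePreserving_rotField _) h
  refine h1.congr' fun t _ prev u' v φ ψ => ?_
  simp only [rotField_apply]
  rfl

/-- **(5.8.1) AT MEASURE LEVEL — *"we make a translation φ = φ^{(k)} + aL⁻²Λ₇^{(k)}C^{(k)}_{loc}(u_{k+1})Q*(u_{k+1})ψ"***: for any family of shifts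
`c_t({u^{(j)}}, u′, v, ψ) ∈ ℂ^{T₁}` (the printed one depends on `u_{k+1} = u_{k+1}(u′, v)` and linearly on `ψ`), a density satisfying line 1 of (5.9.6)
with bracket `J` satisfies it with the bracket evaluated at `φ = φ^{(k)} + c`, the integration variable being `φ^{(k)}` (translation invariance of
the Lebesgue measure `𝒟φ` on `ℂ^{T₁}`, `ψ` fixed in the innermost integral).  After this substitution the `ψ`-Gaussian of (5.1.1) is spread over
the quadratic forms (5.8.2)–(5.8.3) — the reason the bracket of (5.9.6) is carried as one integrand. [cite: BalabanImbrieJaffe1988, (5.8.1) p.295] -/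
theorem isDT_translatePhi (c : ι → Prev P k → GaugeField P k U1 → GaugeField P (k+1) U1 → HiggsField P (k+1) → HiggsField P k)
    (h : IsDT ν terms Λ Qu J ρL) :
    IsDT ν terms Λ Qu (fun t prev u' v φ ψ => J t prev u' v (φ + c t prev u' v ψ) ψ) ρL :=
  isDT_substPhi (fun t prev u' v ψ => MeasurableEquiv.addRight (c t prev u' v ψ))
    (fun t _ prev u' v ψ => measurePreserving_add_right volume (c t prev u' v ψ)) h

end Phi

/-! ## §2 The renaming `ψ′ → ψ`: a different density with the same `[F]` -/

section Rename

variable {ι : Type*} {ν : Measure (GaugeField P k U1)} {terms : Finset ι} {Λ : ι → Finset (PBond P (k+1))}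
variable {Qu : GaugeField P k U1 → GaugeField P (k+1) U1}
variable {J₁ J₂ : ι → Prev P k → GaugeField P k U1 → GaugeField P (k+1) U1 → HiggsField P k → HiggsField P (k+1) → ℂ}
variable {ρ₁ ρ₂ : GaugeField P (k+1) U1 → HiggsField P (k+1) → ℂ}

/-- kernel: **one term of the display under the renaming** — if `J₁(…, φ, ψ) = J₂(…, φ, λψ)` with `λ = λ_t({u^{(j)}}, u′, v)` and `g(v, μψ) = g(v, ψ)`
for all site phases `μ`, then at fixed outer variables `∫dψ∫𝒟φ J₁(φ, ψ) g(v, ψ) = ∫dψ∫𝒟φ J₂(φ, ψ) g(v, ψ)` (the rotation `ψ ↦ λψ` preserves `dψ`: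
r18's `measurePreserving_rotField` at level `k + 1`). [cite: BalabanImbrieJaffe1988, (5.4.6) p.282] -/
theorem term_rename_eq (lam : GaugeTransf P (k+1) U1) {F₁ F₂ : HiggsField P k → HiggsField P (k+1) → ℂ}
    (hF : ∀ φ ψ, F₁ φ ψ = F₂ φ (twist lam ψ)) {g₀ : HiggsField P (k+1) → ℂ} (hg : ∀ ψ, g₀ (twist lam ψ) = g₀ ψ) :
    ∫ ψ, ∫ φ, F₁ φ ψ * g₀ ψ = ∫ ψ, ∫ φ, F₂ φ ψ * g₀ ψ := by
  have e : (fun ψ => ∫ φ, F₁ φ ψ * g₀ ψ) = fun ψ => (fun ψ' => ∫ φ, F₂ φ ψ' * g₀ ψ') (rotField lam ψ) := by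
    funext ψ
    have hr : rotField lam ψ = twist lam ψ := by rw [rotField_apply]; rfl
    simp only [hr, hF, hg]
  rw [e]
  exact (measurePreserving_rotField lam).integral_comp' (fun ψ' => ∫ φ, F₂ φ ψ' * g₀ ψ')

/-- **p. 282: *"We have not yet integrated over ψ, so a different density is obtained by replacing ψ′ with ψ. However, the new density
ρ^L_{k+1}(v, ψ) still has the property that ∫dvdψ ρ^L_{k+1}(v, ψ) = [F]"*** — PROVED at measure level, in the sharper form: let the old bracket be
the new one at the rotated block field, `J₁_t({u^{(j)}}, u′, v, φ, ψ) = J₂_t({u^{(j)}}, u′, v, φ, λ_tψ)` with a `U(1)`-valued site field `λ_t({u^{(j)}}, u′, v)`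
(printed: `ψ′ = ψe^{ie_k(Λ̄₃^{(k)}C_{k,loc}A′)}`; it may depend on everything but `φ`, `ψ`), and let `ρ₁`, `ρ₂` satisfy line 1 of (5.9.6) with the
brackets `J₁`, `J₂` (same `ν`, terms, cut-offs, `Q`).  Then `∫dvdψ ρ₂ g = ∫dvdψ ρ₁ g` for EVERY bounded measurable test function invariant under the site
rotations of `ψ`, `g(v, μψ) = g(v, ψ)` — the two densities have the same integrals against all gauge-invariant observables of the block fields
(`g ≡ 1`: the same total integral, `integral_eq_of_rename_one`); they differ in general. [cite: BalabanImbrieJaffe1988, (5.4.6) p.282] -/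
theorem integral_eq_of_rename (lam : ι → Prev P k → GaugeField P k U1 → GaugeField P (k+1) U1 → GaugeTransf P (k+1) U1)
    (hJ : ∀ t ∈ terms, ∀ prev u' v φ ψ, J₁ t prev u' v φ ψ = J₂ t prev u' v φ (twist (lam t prev u' v) ψ))
    (h₁ : IsDT ν terms Λ Qu J₁ ρ₁) (h₂ : IsDT ν terms Λ Qu J₂ ρ₂)
    {g : GaugeField P (k+1) U1 × HiggsField P (k+1) → ℂ} (hg : Measurable g) (hb : ∃ C : ℝ, ∀ z, ‖g z‖ ≤ C)
    (hginv : ∀ (μ : GaugeTransf P (k+1) U1) v ψ, g (v, twist μ ψ) = g (v, ψ)) :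
    ∫ v, ∫ ψ, ρ₂ v ψ * g (v, ψ) ∂volume ∂fieldMeasure P (k+1) U1 = ∫ v, ∫ ψ, ρ₁ v ψ * g (v, ψ) ∂volume ∂fieldMeasure P (k+1) U1 := by
  rw [h₁ g hg hb, h₂ g hg hb]
  refine Finset.sum_congr rfl fun t ht => ?_
  refine integral_congr_ae (ae_of_all _ fun v' => integral_congr_ae (ae_of_all _ fun U => ?_))
  refine integral_congr_ae (ae_of_all _ fun prev => ?_)
  dsimp only
  exact (term_rename_eq (lam t prev (uCut Qu (Λ t) U) (vCut Qu (Λ t) U v'))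
    (fun φ ψ => hJ t ht prev _ _ φ ψ) (fun ψ => hginv _ _ ψ)).symm

/-- **∫dvdψ ρ₂ = ∫dvdψ ρ₁** — *"the new density ρ^L_{k+1}(v, ψ) still has the property that ∫dvdψ ρ^L_{k+1}(v, ψ) = [F]"* (the old one had it:
gens 5–8, `BIJ88RT51NoChange.bracket_eq_integral_of_isRT511` with `BIJ88RT52Restrictions.integral_eq_of_isRD_const` along the operations).
[cite: BalabanImbrieJaffe1988, (5.4.6) p.282] -/
theorem integral_eq_of_rename_one (lam : ι → Prev P k → GaugeField P k U1 → GaugeField P (k+1) U1 → GaugeTransf P (k+1) U1)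
    (hJ : ∀ t ∈ terms, ∀ prev u' v φ ψ, J₁ t prev u' v φ ψ = J₂ t prev u' v φ (twist (lam t prev u' v) ψ))
    (h₁ : IsDT ν terms Λ Qu J₁ ρ₁) (h₂ : IsDT ν terms Λ Qu J₂ ρ₂) :
    ∫ v, ∫ ψ, ρ₂ v ψ ∂volume ∂fieldMeasure P (k+1) U1 = ∫ v, ∫ ψ, ρ₁ v ψ ∂volume ∂fieldMeasure P (k+1) U1 := by
  have h := integral_eq_of_rename lam hJ h₁ h₂ (g := fun _ => (1 : ℂ)) measurable_const ⟨1, fun _ => by simp⟩ (fun _ _ _ => rfl)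
  simpa only [mul_one] using h

/-- **The marginals in `v` of `ρ₂·h` and `ρ₁·h` agree for every rotation-invariant bounded measurable `h(ψ)`** (test functions `g(v)h(ψ)`): e.g. the
`v`-marginals themselves (`h ≡ 1`), or weighted with functions of `|ψ(y)|`. [cite: BalabanImbrieJaffe1988, (5.4.6) p.282] -/
theorem integral_eq_of_rename_prod (lam : ι → Prev P k → GaugeField P k U1 → GaugeField P (k+1) U1 → GaugeTransf P (k+1) U1)
    (hJ : ∀ t ∈ terms, ∀ prev u' v φ ψ, J₁ t prev u' v φ ψ = J₂ t prev u' v φ (twist (lam t prev u' v) ψ))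
    (h₁ : IsDT ν terms Λ Qu J₁ ρ₁) (h₂ : IsDT ν terms Λ Qu J₂ ρ₂)
    {g₁ : GaugeField P (k+1) U1 → ℂ} (hg₁ : Measurable g₁) {C₁ : ℝ} (hC₁ : ∀ v, ‖g₁ v‖ ≤ C₁)
    {h₀ : HiggsField P (k+1) → ℂ} (hh₀ : Measurable h₀) {C₂ : ℝ} (hC₂ : ∀ ψ, ‖h₀ ψ‖ ≤ C₂) (hinv : ∀ (μ : GaugeTransf P (k+1) U1) ψ, h₀ (twist μ ψ) = h₀ ψ) :
    ∫ v, ∫ ψ, ρ₂ v ψ * (g₁ v * h₀ ψ) ∂volume ∂fieldMeasure P (k+1) U1 = ∫ v, ∫ ψ, ρ₁ v ψ * (g₁ v * h₀ ψ) ∂volume ∂fieldMeasure P (k+1) U1 := by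
  have hC₁' : 0 ≤ C₁ := le_trans (norm_nonneg _) (hC₁ 1)
  refine integral_eq_of_rename lam hJ h₁ h₂ (g := fun z => g₁ z.1 * h₀ z.2) ((hg₁.comp measurable_fst).mul (hh₀.comp measurable_snd))
    ⟨C₁ * C₂, fun z => ?_⟩ (fun μ v ψ => by simp only [hinv])
  rw [norm_mul]
  exact mul_le_mul (hC₁ _) (hC₂ _) (norm_nonneg _) hC₁'

end Rename

end

end Literature.MathematicalPhysics.QuantumFieldTheory.BalabanImbrieJaffe1984to88.BIJ88RT54ScalarSubst
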